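import Summits.Ventures.PercRepro.RankLevelSetPerElemCircuit
import Summits.Ventures.PercRepro.RankLevelSetPerElemTwo

/-! # RankLevelSetAbsorbStarNullity — (ABS-star) AT EVERY STEP ON COLOOP-FREE MATROIDS OF NULLITY AT MOST `3`, AT
EVERY ELEMENT IN NO PARALLEL PAIR, BY ONE UP-SHADOW STEP PER CIRCUIT (night-1 g36; dossier §48.14; on
`RankLevelSetPerElemCircuit`)

The step `(#E − 1 − k) · A^y_k ≤ k · A^y_{k+1}` of (ABS-star) is also per circuit: the members of a circuit `K`
at level `k` are the sets `S ∪ X` for `X` in the hyperplane family at level `k − s`, and the members at level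
`k + 1` those for `X` at level `k + 1 − s` (`fam_le_absorb`), so ONE up-shadow step `absorbFam_step` gives
`(h − i − (ρ − 1)) · f i ≤ (i + 1) · f (i + 1)` with `i = k − s`, `h = #E − 1 − s`, and the step follows whenever
`s · (#E − 1 − k) ≥ #E − 1 − 2k + k · ρ` — for `ρ ≤ 2` (the dual of rank `≤ 3`, i.e. nullity `≤ 3`) this is
`2(#E − 1 − k) ≥ #E − 1`, true below the middle (`2k + 1 ≤ #E`, `3 ≤ k`) since every circuit has `s ≥ 2`
(**`absorbStar_perCircuit_of_nullity`**). Summed over the circuits (**`absorbStar_step_of_perCircuit`**, the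
fiberwise sum of the members and of the members one level up) this is **`absorbStar_step_of_nullity`**:
`(∀ e, ¬ IsColoop e) → (∀ z ≠ y, y ∉ cl {z}) → rk M✶ ≤ 3 → 3 ≤ k → 2k + 1 ≤ #E → (#E − 1 − k) · A^y_k ≤ k · A^y_{k+1}`.
With the steps `k ≤ 3` of `absorbStar_of_le_three_all` this is the class theorem
**`biIndepAbsorbStar_of_simple_coloopFree_of_nullity`**: (ABS-star) holds on every loopless matroid without parallel
pairs and coloops whose dual has rank `≤ 3`. (The same single step with `ρ ≤ k − 1` reproduces g34's bound
`#E ≥ k² − k + 1`.) Every declaration has a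
docstring; imports: the cell's own modules and Mathlib only. Axioms: standard. -/

namespace PercRepro

open Set Matroid

variable {α : Type} (M : Matroid α) [M.Finite]

/-! ## The hyperplane family one level up injects into the absorbing sets -/

/-- **The hyperplane family at level `i` injects into the absorbing `(i + s)`-sets with circuit `K`** by
`X ↦ S ∪ X` (`K = C_y(Z₀)`, `s = #S`). -/
lemma fam_le_absorb {y : α} (hy : y ∈ M.E) {j : ℕ} {Z₀ : Set α} (hZ₀ : Z₀ ∈ lowAbsorbAt M y j) (i : ℕ) :
    {X | X ⊆ M.E \ M.fundCircuit y Z₀ ∧ X.ncard = i ∧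
        M✶.Spanning ((M.fundCircuit y Z₀ \ {y}) ∪ X) ∧
        M✶.Spanning (insert y ((M.E \ M.fundCircuit y Z₀) \ X))}.ncard ≤
      {Z ∈ lowAbsorbAt M y (i + (M.fundCircuit y Z₀ \ {y}).ncard) |
        M.fundCircuit y Z = M.fundCircuit y Z₀}.ncard := by
  have hycl := mem_closure_of_mem_lowAbsorbAt' M hy hZ₀
  obtain ⟨⟨hZE, -, hZi, -⟩, hyZ, -⟩ := hZ₀
  set K := M.fundCircuit y Z₀ with hK
  set S := K \ {y} with hS
  set H := M.E \ K with hH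
  have hKcirc : M.IsCircuit K := hZi.fundCircuit_isCircuit hycl hyZ
  have hyK : y ∈ K := M.mem_fundCircuit y Z₀
  have hKsub : K ⊆ insert y Z₀ := M.fundCircuit_subset_insert y Z₀
  have hKE : K ⊆ M.E := hKsub.trans (Set.insert_subset hy hZE)
  have hKeq : K = insert y S := by rw [hS, Set.insert_sdiff_singleton, Set.insert_eq_of_mem hyK]
  have hSE : S ⊆ M.E := Set.sdiff_subset.trans hKE
  have hSfin : S.Finite := M.ground_finite.subset hSE
  have hHE : H ⊆ M.E := Set.sdiff_subset
  have hHfin : H.Finite := M.ground_finite.subset hHE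
  have hyS : y ∉ S := fun h => h.2 (Set.mem_singleton y)
  have hyH : y ∉ H := fun h => h.2 hyK
  have hdisj : Disjoint S H := Set.disjoint_left.mpr (fun x hxS hxH => hxH.2 hxS.1)
  have hfin : {Z ∈ lowAbsorbAt M y (i + S.ncard) | M.fundCircuit y Z = K}.Finite :=
    (lowAbsorbAt_finite M y _).subset (fun Z hZ => hZ.1)
  refine Set.ncard_le_ncard_of_injOn (fun X => S ∪ X) ?_ ?_ hfin
  · rintro X ⟨hXH, hXi, hXs, hXy⟩
    have hXfin : X.Finite := hHfin.subset hXH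
    have hXE : X ⊆ M.E := hXH.trans hHE
    have hSXE : S ∪ X ⊆ M.E := Set.union_subset hSE hXE
    have hdXS : Disjoint S X := hdisj.mono_right hXH
    -- `E ∖ (S ∪ X) = insert y (H ∖ X)`
    have hcompl : M.E \ (S ∪ X) = insert y (H \ X) := by
      ext x
      constructor
      · rintro ⟨hxE, hx⟩
        simp only [Set.mem_union, not_or] at hx
        by_cases hxy : x = y
        · exact Or.inl hxy
        · refine Or.inr ⟨⟨hxE, fun hxK => ?_⟩, hx.2⟩
          exact hx.1 ⟨hxK, by simpa using hxy⟩
      · rintro (rfl | ⟨⟨hxE, hxK⟩, hxX⟩)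
        · exact ⟨hy, by simp only [Set.mem_union, not_or]; exact ⟨hyS, fun h => hyH (hXH h)⟩⟩
        · exact ⟨hxE, by simp only [Set.mem_union, not_or]; exact ⟨fun h => hxK h.1, hxX⟩⟩
    have hSXi : M.Indep (S ∪ X) := by
      rw [indep_iff_dual_spanning_compl M hSXE, hcompl]; exact hXy
    have hySX : y ∉ S ∪ X := by simp only [Set.mem_union, not_or]; exact ⟨hyS, fun h => hyH (hXH h)⟩
    refine ⟨⟨⟨hSXE, ?_, hSXi, ?_⟩, hySX, ?_⟩, ?_⟩
    · rw [Set.ncard_union_eq hdXS hSfin hXfin, hXi, add_comm]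
    · rw [indep_compl_iff_dual_spanning M hSXE]; exact hXs
    · intro hind
      exact hKcirc.dep.not_indep (hind.subset (by rw [hKeq]; exact Set.insert_subset_insert Set.subset_union_left))
    · exact (hKcirc.eq_fundCircuit_of_subset hSXi
        (by rw [hKeq]; exact Set.insert_subset_insert Set.subset_union_left)).symm
  · rintro X₁ ⟨hX₁, -, -, -⟩ X₂ ⟨hX₂, -, -, -⟩ heq
    have heq' : S ∪ X₁ = S ∪ X₂ := heq
    have h1 := hdisj.mono_right hX₁
    have h2 := hdisj.mono_right hX₂
    have := congrArg (fun T => T \ S) heq'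
    simpa [Set.union_sdiff_left, h1.sdiff_eq_right, h2.sdiff_eq_right] using this

/-! ## The per-circuit step under a nullity bound -/

/-- **THE PER-CIRCUIT STEP OF (ABS-star) WHEN `rk M✶ ≤ 3`** (coloop-free `M`, `y` in no parallel pair, `3 ≤ k`,
`2k + 1 ≤ #E`; the up-shadow step needs `k − s + 2 < #H`, i.e. `k + 3 < #E`):
`(#E − 1 − k) · #members(K, k) ≤ k · #members(K, k + 1)` — one up-shadow step with `ρ = 2`. -/
theorem absorbStar_perCircuit_of_nullity (hcol : ∀ e, ¬ M.IsColoop e) {y : α} (hy : y ∈ M.E)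
    (hnp : ∀ z, z ≠ y → y ∉ M.closure {z}) (hν : M✶.eRank ≤ 3) {k : ℕ} (hk3 : 3 ≤ k)
    (hk : 2 * k + 1 ≤ M.E.ncard) {Z₀ : Set α} (hZ₀ : Z₀ ∈ lowAbsorbAt M y k) :
    (M.E.ncard - 1 - k) * {Z ∈ lowAbsorbAt M y k | M.fundCircuit y Z = M.fundCircuit y Z₀}.ncard ≤
      k * {Z ∈ lowAbsorbAt M y (k + 1) | M.fundCircuit y Z = M.fundCircuit y Z₀}.ncard := by
  obtain ⟨hKeq, hSZ, hSE, hHE, -, -, hHy, hyH, hnl, -⟩ := circuit_dual_facts M hcol hy hZ₀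
  have h1 := members_le_fam M hy hZ₀
  have h2 := fam_le_absorb M hy hZ₀ (k + 1 - (M.fundCircuit y Z₀ \ {y}).ncard)
  obtain ⟨z₀, hz₀⟩ : (M.E \ {y}).Nonempty := by
    rw [← Set.ncard_pos (M.ground_finite.subset Set.sdiff_subset), Set.ncard_sdiff_singleton_of_mem hy]
    omega
  have hz₀y : z₀ ≠ y := by simpa using hz₀.2
  have hK3 := (fundCircuit_ncard_absorb M hy hnp hz₀y hZ₀).1
  have hZE : Z₀ ⊆ M.E := hZ₀.1.1
  have hZk : Z₀.ncard = k := hZ₀.1.2.1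
  set K := M.fundCircuit y Z₀ with hK'
  set S := K \ {y} with hS
  set H := M.E \ K with hH
  have hyK : y ∈ K := M.mem_fundCircuit y Z₀
  have hKE : K ⊆ M.E := hKeq ▸ Set.insert_subset hy hSE
  have hKfin : K.Finite := M.ground_finite.subset hKE
  have hKcard : K.ncard = S.ncard + 1 := by
    rw [hS, Set.ncard_sdiff_singleton_of_mem hyK]
    have : 1 ≤ K.ncard := (Set.ncard_pos hKfin).mpr ⟨y, hyK⟩
    omega
  have hKle : K.ncard ≤ M.E.ncard := Set.ncard_le_ncard hKE M.ground_finite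
  have hHcard : H.ncard + K.ncard = M.E.ncard := by
    rw [hH, Set.ncard_sdiff hKE hKfin]; omega
  have hsk : S.ncard ≤ k := by
    rw [← hZk]; exact Set.ncard_le_ncard hSZ (M.ground_finite.subset hZE)
  have hyE' : y ∈ M✶.E := by rwa [Matroid.dual_ground]
  have hHE' : H ⊆ M✶.E := by rwa [Matroid.dual_ground]
  have hSE' : S ⊆ M✶.E := by rwa [Matroid.dual_ground]
  have hρ : M✶.eRk H ≤ ((2 : ℕ) : ℕ∞) := by
    have h : M✶.eRk H + 1 ≤ ((2 : ℕ) : ℕ∞) + 1 := by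
      rw [eRk_add_one_eq_eRank_of_spanning_insert hyE' hyH hHy]
      exact hν
    exact (WithTop.add_le_add_iff_right (by decide)).mp h
  have hstep := absorbFam_step (S := S) hHE' hSE' hyE' hyH hHy hnl hρ (by norm_num)
    (i := k - S.ncard) (by omega)
  have e1 : k + 1 - S.ncard = k - S.ncard + 1 := by omega
  rw [e1] at h2
  set f : ℕ → ℕ := fun i =>
    {X | X ⊆ H ∧ X.ncard = i ∧ M✶.Spanning (S ∪ X) ∧ M✶.Spanning (insert y (H \ X))}.ncard with hf
  have hstep' : (H.ncard - (k - S.ncard) - (2 - 1)) * f (k - S.ncard) ≤ (k - S.ncard + 1) * f (k - S.ncard + 1) :=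
    hstep
  -- arithmetic: `(n − 1 − k) · m ≤ (n − 1 − k) · f i`, `f i · (h − i − 1) ≤ (i + 1) · f (i + 1)`, `f (i + 1) ≤ t`
  have hm : {Z ∈ lowAbsorbAt M y k | M.fundCircuit y Z = K}.ncard ≤ f (k - S.ncard) := h1
  have ht : f (k - S.ncard + 1) ≤ {Z ∈ lowAbsorbAt M y (k + 1) | M.fundCircuit y Z = K}.ncard := by
    have := h2
    rwa [show k - S.ncard + 1 + S.ncard = k + 1 by omega] at this
  -- `(n − 1 − k) · (i + 1) ≤ k · (h − i − 1)` where `i = k − s`, `h = n − 1 − s`: this is `s(n − 1 − k) ≥ n − 1`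
  have hcoef : (M.E.ncard - 1 - k) * (k - S.ncard + 1) ≤ k * (H.ncard - (k - S.ncard) - (2 - 1)) := by
    have hs2 : 2 ≤ S.ncard := by omega
    obtain ⟨d, hd⟩ := Nat.exists_eq_add_of_le hsk
    obtain ⟨s', hs'⟩ := Nat.exists_eq_add_of_le hs2
    obtain ⟨a', ha'⟩ : ∃ a', M.E.ncard - 1 - k = a' + 1 := ⟨M.E.ncard - 2 - k, by omega⟩
    have e3 : H.ncard - (k - S.ncard) - (2 - 1) = a' := by omega
    have e2 : k - S.ncard + 1 = d + 1 := by omega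
    have hka : 2 + s' + d ≤ a' + 1 := by omega
    rw [ha', e2, e3, hd, hs']
    nlinarith [Nat.zero_le (s' * a'), hka]
  have key : (k - S.ncard + 1) * ((M.E.ncard - 1 - k) * f (k - S.ncard)) ≤
      (k - S.ncard + 1) * (k * f (k - S.ncard + 1)) := by
    calc (k - S.ncard + 1) * ((M.E.ncard - 1 - k) * f (k - S.ncard))
        = ((M.E.ncard - 1 - k) * (k - S.ncard + 1)) * f (k - S.ncard) := by ring
      _ ≤ (k * (H.ncard - (k - S.ncard) - (2 - 1))) * f (k - S.ncard) := Nat.mul_le_mul_right _ hcoef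
      _ = k * ((H.ncard - (k - S.ncard) - (2 - 1)) * f (k - S.ncard)) := by ring
      _ ≤ k * ((k - S.ncard + 1) * f (k - S.ncard + 1)) := Nat.mul_le_mul_left _ hstep'
      _ = (k - S.ncard + 1) * (k * f (k - S.ncard + 1)) := by ring
  have key' := Nat.le_of_mul_le_mul_left key (by omega)
  calc (M.E.ncard - 1 - k) * {Z ∈ lowAbsorbAt M y k | M.fundCircuit y Z = K}.ncard
      ≤ (M.E.ncard - 1 - k) * f (k - S.ncard) := Nat.mul_le_mul_left _ hm
    _ ≤ k * f (k - S.ncard + 1) := key'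
    _ ≤ k * {Z ∈ lowAbsorbAt M y (k + 1) | M.fundCircuit y Z = K}.ncard := Nat.mul_le_mul_left _ ht

/-! ## The fiberwise sum and the class theorem -/

/-- **A weighted per-circuit inequality between two absorbing levels sums to the levels**: if
`c₁ · #members(K, k) ≤ c₂ · #members(K, k + 1)` for every circuit class `K` of the absorbing `k`-sets, then
`c₁ · A^y_k ≤ c₂ · A^y_{k+1}` (the circuits not met at level `k` only add members at level `k + 1`). -/
lemma absorbStar_step_of_perCircuit {y : α} (k c₁ c₂ : ℕ)
    (hK : ∀ Z₀ ∈ lowAbsorbAt M y k,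
      c₁ * {Z ∈ lowAbsorbAt M y k | M.fundCircuit y Z = M.fundCircuit y Z₀}.ncard ≤
        c₂ * {Z ∈ lowAbsorbAt M y (k + 1) | M.fundCircuit y Z = M.fundCircuit y Z₀}.ncard) :
    c₁ * (lowAbsorbAt M y k).ncard ≤ c₂ * (lowAbsorbAt M y (k + 1)).ncard := by
  classical
  set f : Set α → Set α := fun Z => M.fundCircuit y Z with hf
  have hmfin : (lowAbsorbAt M y k).Finite := lowAbsorbAt_finite M y k
  have htfin : (lowAbsorbAt M y (k + 1)).Finite := lowAbsorbAt_finite M y (k + 1)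
  set A := hmfin.toFinset with hA
  set B := htfin.toFinset with hB
  have hcardA : ∀ K, (A.filter (fun Z => f Z = K)).card = {Z ∈ lowAbsorbAt M y k | f Z = K}.ncard := by
    intro K
    rw [← Set.ncard_coe_finset, Finset.coe_filter]
    congr 1
    ext Z
    simp only [Set.mem_setOf_eq, hA, Set.Finite.mem_toFinset]
  have hcardB : ∀ K, (B.filter (fun Z => f Z = K)).card =
      {Z ∈ lowAbsorbAt M y (k + 1) | f Z = K}.ncard := by
    intro K
    rw [← Set.ncard_coe_finset, Finset.coe_filter]
    congr 1
    ext Z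
    simp only [Set.mem_setOf_eq, hB, Set.Finite.mem_toFinset]
  have h1 : A.card = ∑ K ∈ A.image f, (A.filter (fun Z => f Z = K)).card :=
    Finset.card_eq_sum_card_image f A
  have h2 : (B.filter (fun Q => f Q ∈ A.image f)).card =
      ∑ K ∈ A.image f, ((B.filter (fun Q => f Q ∈ A.image f)).filter (fun Q => f Q = K)).card :=
    Finset.card_eq_sum_card_fiberwise (fun Q hQ => (Finset.mem_filter.mp hQ).2)
  have h3 : ∀ K ∈ A.image f, c₁ * (A.filter (fun Z => f Z = K)).card ≤
      c₂ * ((B.filter (fun Q => f Q ∈ A.image f)).filter (fun Q => f Q = K)).card := by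
    intro K hK'
    obtain ⟨Z₀, hZ₀A, rfl⟩ := Finset.mem_image.mp hK'
    have hZ₀ : Z₀ ∈ lowAbsorbAt M y k := hmfin.mem_toFinset.mp hZ₀A
    have hsub : B.filter (fun Q => f Q = f Z₀) ⊆
        (B.filter (fun Q => f Q ∈ A.image f)).filter (fun Q => f Q = f Z₀) := by
      intro Q hQ
      rw [Finset.mem_filter] at hQ
      rw [Finset.mem_filter, Finset.mem_filter]
      exact ⟨⟨hQ.1, hQ.2 ▸ hK'⟩, hQ.2⟩
    calc c₁ * (A.filter (fun Z => f Z = f Z₀)).card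
        = c₁ * {Z ∈ lowAbsorbAt M y k | f Z = f Z₀}.ncard := by rw [hcardA]
      _ ≤ c₂ * {Z ∈ lowAbsorbAt M y (k + 1) | f Z = f Z₀}.ncard := hK Z₀ hZ₀
      _ = c₂ * (B.filter (fun Q => f Q = f Z₀)).card := by rw [hcardB]
      _ ≤ _ := Nat.mul_le_mul_left _ (Finset.card_le_card hsub)
  have h4 : (B.filter (fun Q => f Q ∈ A.image f)).card ≤ B.card :=
    Finset.card_le_card (Finset.filter_subset _ _)
  have h5 : c₁ * A.card ≤ c₂ * B.card := by
    rw [h1, Finset.mul_sum]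
    refine le_trans (Finset.sum_le_sum h3) ?_
    rw [← Finset.mul_sum, ← h2]
    exact Nat.mul_le_mul_left _ h4
  rw [Set.ncard_eq_toFinset_card _ hmfin, Set.ncard_eq_toFinset_card _ htfin]
  exact h5

/-- **(ABS-star) AT EVERY STEP `k ≥ 3` ON A COLOOP-FREE MATROID OF NULLITY `≤ 3` AT AN ELEMENT IN NO PARALLEL PAIR**
(`rk M✶ ≤ 3`, `2k + 1 ≤ #E`): `(#E − 1 − k) · A^y_k ≤ k · A^y_{k+1}` — one up-shadow step per circuit, summed. -/
theorem absorbStar_step_of_nullity (hcol : ∀ e, ¬ M.IsColoop e) {y : α} (hy : y ∈ M.E)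
    (hnp : ∀ z, z ≠ y → y ∉ M.closure {z}) (hν : M✶.eRank ≤ 3) {k : ℕ} (hk3 : 3 ≤ k)
    (hk : 2 * k + 1 ≤ M.E.ncard) :
    (M.E.ncard - 1 - k) * lowAbsorbCount M y k ≤ k * lowAbsorbCount M y (k + 1) := by
  unfold lowAbsorbCount
  exact absorbStar_step_of_perCircuit M k (M.E.ncard - 1 - k) k
    (fun Z₀ hZ₀ => absorbStar_perCircuit_of_nullity M hcol hy hnp hν hk3 hk hZ₀)

/-- **(ABS-star) HOLDS ON EVERY LOOPLESS MATROID WITHOUT PARALLEL PAIRS AND COLOOPS WHOSE DUAL HAS RANK `≤ 3`**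
(nullity `≤ 3`): the steps `k ≤ 3` are `absorbStar_of_le_three_all`, the steps `k ≥ 3` one up-shadow step per circuit. -/
theorem biIndepAbsorbStar_of_simple_coloopFree_of_nullity [DecidableEq α] (hl : ∀ e, ¬ M.IsLoop e)
    (hp : ∀ u v, ¬ ParallelPair M u v) (hcol : ∀ e, ¬ M.IsColoop e) (hν : M✶.eRank ≤ 3) :
    BiIndepAbsorbStar M := by
  intro y hy k hk
  rcases Nat.lt_or_ge k 3 with h2 | h3
  · exact absorbStar_of_le_three_all M hy (by omega) hk
  · exact absorbStar_step_of_nullity M hcol hy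
      (fun _ hz => notMem_closure_singleton_of_no_partner M hy (hl y) (hp y) hz) hν h3 hk

end PercRepro
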